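import Literature.MathematicalPhysics.QuantumFieldTheory.Balaban1983to89.B9CoReadingCoordsHolderS

/-!
# `Balaban1983to89.B9CoReadingCoordsHolderSAdm` — THE BLOCK-CUT HÖLDER PROBE FAMILY of the κ-fold coordinate model, SITE SECTOR (the site pin carrier with the pair probes
# restricted to pairs INSIDE ONE BLOCK), and the (3.43) co-reading `H1ReadsNbr` of def-Y's `kernelFamilyS` AT IT, for every letter and every configuration

T. Bałaban, *Propagators for lattice gauge theories in a background field*, Commun. Math. Phys. **99** (1985) 389–434
[`Balaban1985BackgroundPropagators`, "B9"]; [4] = T. Bałaban, *Propagators and renormalization transformations for lattice gauge theories. II*, Commun. Math.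
Phys. **96** (1984) 223–250 [`Balaban1984PropagatorsII`].

statement-level skeleton of published theorems with citation tags; proofs where landed; nothing here is a claim about the Yang–Mills mass gap

THE PRINT.  [B9] (3.40) p. 397 («sup_{x,x′:|x−x′|≦1}»); (3.43) p. 398 («ζ ∈ C₀^∞(Δ̃(y))»); [4] (2.67) p. 234.

WHY THIS FILE (cell `pub-ymgap`, Track A node N06 [B9]; seat `pub-ymgap-dag-n06-w6`, supplier offer to the pin owner dag-n06-d; SITE twin of `B9CoReadingCoordsHolderAdm`).
n06-d's site pin carrier `holderProbesS` indexes its pair probes by ALL pairs of sites with the weight `wS α z z′ = ((|z′−z|_T η)^α)⁻¹ > 0` (def-Y's `hqS` is uncut by design,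
WORD-OBS1-DOWN (2)(4)); every probe-valued displayed majorant of rows 18 at the pin `𝔭 x = holderProbesS …` therefore demands the FAR pair probes too (OBS-1 ∕ LOCATED-1 one
sector over).  The product rule `B9CoReadingCoordsHolderS.hqS_le_of_probes` invokes the pair probe `((z, z′), …)` ONLY in the case `ζ(z) ≠ 0 ≠ ζ(z′)`, i.e. with BOTH sites
in `supp ζ ⊂` the block `β y` (the site cut-off class is block-sharp: `cutIn ζ y ↔ ∀ w, ζ w ≠ 0 → blkOf w = β y`); the far pairs with one vanishing cut-off value are served by
the point ∕ transported-point probes.  Hence the cut «both sites in ONE block» re-proves it VERBATIM: `wSA α z z′ := wS α z z′` if `blkOf z = blkOf z′`, else `0`;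
`holderProbesSA := holderProbesS` with `wSA` (same lattice `PK`, same anchors `blkPK (sIK bI)`, point and transported-point probes unchanged) — and a same-block pair has
`|z − z′|_∞` below the block side, inside print's (3.40) regime.
* §1 `wSA` (`wSA_of_eq`, `wSA_of_ne`, `wSA_nonneg`), ★ `holderProbesSA`, the probe values `ΦX_SA_inl_of_eq ∕ _of_ne ∕ _inr_inl ∕ _inr_inr`, `ΦY_SA_eq_ΦX_SA`.
* §2 ★★ `hqS_le_of_probesSA` — n06-d's site product rule with the hypothesis on the cut family only (proof re-run; the pair step under `blkOf z = blkOf z′ = β y`).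
* §3 ★★ `h1ReadsNbr_kernelFamilyS_coordsSA`, ★ `site_h1ReadsNbr_of_pinsSA` — the (3.43) co-reading `H1ReadsNbr (kernelFamilyS …) U₁ (holderProbesSA …) …` and its form under the
  certificate's site pins (the twin of `site_h1ReadsNbr_of_pins`, ed. 27's `hH1`).  The site INPUT co-reading twin (`site_inputReadsFam_of_pins`, `hIR`) is the sequel
  `B9CoReadingCoordsHolderSAdmReadings`.

HONEST SCOPE.  A sibling DEFINITION of the site pin carrier plus verbatim re-proofs of n06-d's landed co-reading theorems at it; nothing of [B9] or [4] asserted; no certificate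
edition written; COUNT-NEUTRAL; N06 NOT discharged; one finite 𝕋^{d+1} programme at fixed ε — nothing continuum, nothing about the mass gap.  Cell `pub-ymgap` (HUMAN RULING
D-0062), Track A node N06 [B9], seat `pub-ymgap-dag-n06-w6` (g0), 2026-08-28; a NEW file.
-/

noncomputable section

namespace Literature.MathematicalPhysics.QuantumFieldTheory.Balaban1983to89.B9CoReadingCoordsHolderSAdm

open B9Eq39Adjoint (R R_sub R_smul R_zero)
open B4TorusKernel.MultiPeriod (torusSupNorm torusSupNorm_nonneg)
open B6GlobalChartV1 (PV domT blkV1)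
open B6Geom246MultiLevelBox (bset blkOf)
open B6Geom246MultiLevelTorus (geomT triangle_refl_nonneg_T)
open B6Ineq2142KLevelV1 (β lvl)
open B6KLevelCensusIndexV1 (KIdx)
open B6Prop22KLevelTorusCensus (KTIdx)
open B6MultiLevelTorusOperator (one_le_N0)
open B6Prop22KLevelTorusCensusEta (nKT nKT_pos hqTP hqTP_nonneg pair_le_hqTP geoTP)
open B9GeoNormsKLevelV1 (geo9K geo9K_supNorm_nonneg geo9K_cutH_nonneg)
open B9GeoLemma21KLevelV1 (one_le_Mh one_le_P)
open B9CoRealizesRelAtLetters (RelB)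
open B9RWSumsReadsNbr (H1ReadsNbr)
open B9RWSums343Holder (HolderProbes)
open B9Ineq349SiteComposite (cdSL cdsSL etaS_pos)
open B9Thm39ReadingCoords (cR39 cR39_nonneg)
open B9CoReadingCoords (assembleK assembleK_smul evDiagK assembleK_evDiagK coordOpK assembleK_coordOpK coordOpK_evDiagK)
open B9CoReadingCoordsS (XSK evSK blkSK sIK sIK_faithful blkV1_site GcoS DcoS DscoS DcoS_comp_GcoS GcoS_comp_DscoS off_bound_evSK)
open B9CoReadingCoordsL2S (sIK_dist_le_one)
open B9CoReadingCoordsHolder (PK blkPK probeK probeK_inl probeK_inr_inl probeK_inr_inr shiftR transR wnorm_le_of_coords)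
open B9CoReadingCoordsHolderS (wS wS_nonneg holderProbesS)
open Node00 (SiteY FBondY IBondY CfgY BallY liftY liftY_apply hqS hLatS etaS toKT kernelFamilyS SiteOpY SiteParY cdS cdsS iSup_ball_le)

variable {d ℓ : ℕ} {hd : 1 ≤ d + 1} {hL : Odd (ℓ + 1) ∧ 1 < ℓ + 1} {b₀ b₁ : ℝ}
variable {𝔸 : Type} [NormedRing 𝔸] [NormedAlgebra ℂ 𝔸] [CompleteSpace 𝔸]
variable {κ : Type} [Fintype κ] [DecidableEq κ]

/-! ## §1 The block-cut site pair weight and the cut site probe family -/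

section Site

variable (i : KIdx d ℓ hd hL b₀ b₁)

open Classical in
/-- ★ **THE BLOCK-CUT SITE PAIR WEIGHT**: def-Y's site weight `((|z′−z|_T η)^α)⁻¹` on the pairs of sites of ONE block (`blkOf z = blkOf z′` — the only pairs the product rule reads through a
pair probe, `supp ζ ⊂ B(y)`), and `0` on every other pair. [cite: Balaban1985BackgroundPropagators, (3.40) p.397 («sup_{x,x′:|x−x′|≦1}»), (3.43) p.398] -/
def wSA (α : ℝ) (z z' : SiteY i) : ℝ := if blkOf i.D.toDomains z = blkOf i.D.toDomains z' then wS i α z z' else 0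

omit [CompleteSpace 𝔸] in
/-- on a same-block pair the cut weight is def-Y's weight. [cite: Balaban1985BackgroundPropagators, (3.40) p.397, bookkeeping] -/
theorem wSA_of_eq (α : ℝ) {z z' : SiteY i} (h : blkOf i.D.toDomains z = blkOf i.D.toDomains z') : wSA i α z z' = wS i α z z' := by
  unfold wSA; rw [if_pos h]

omit [CompleteSpace 𝔸] in
/-- across blocks the cut weight vanishes. [cite: Balaban1985BackgroundPropagators, (3.40) p.397, bookkeeping] -/
theorem wSA_of_ne (α : ℝ) {z z' : SiteY i} (h : blkOf i.D.toDomains z ≠ blkOf i.D.toDomains z') : wSA i α z z' = 0 := by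
  unfold wSA; rw [if_neg h]

omit [CompleteSpace 𝔸] in
/-- `0 ≤ wSA`. [cite: Balaban1985BackgroundPropagators, (3.40) p.397, bookkeeping] -/
theorem wSA_nonneg (α : ℝ) (z z' : SiteY i) : 0 ≤ wSA i α z z' := by
  unfold wSA; split_ifs
  · exact wS_nonneg i α z z'
  · exact le_rfl

variable (b : Module.Basis κ ℝ 𝔸) (B : B9.Backgrounds) (cfg : B.Cfg → CfgY 𝔸 i) (par : SiteParY 𝔸 i)

/-- ★ **THE BLOCK-CUT HÖLDER PROBES OF THE SITE COORDINATE MODEL** (the site pin carrier with the cut): n06-d's `holderProbesS` with the pair weight `wSA` in place of `wS` — the same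
probe lattice `PK`, the same anchors `blkPK (sIK bI)`, the same point (`1`-weighted) and transported-point probes.
[cite: Balaban1985BackgroundPropagators, (3.40) p.397 + (3.43) p.398; Balaban1984PropagatorsII, (2.51) p.232, (2.67) p.234] -/
def holderProbesSA (bI : FBondY i → IBondY i) :
    HolderProbes (geo9K i) B (XSK κ i) (XSK κ i) (PK (SiteY i) (Fin (d + 1)) κ) (PK (SiteY i) (Fin (d + 1)) κ) where
  blkPX := blkPK (sIK i bI)
  blkPY := blkPK (sIK i bI)
  ΦX := fun U α => probeK b (fun x x' : SiteY i => par (cfg U) x x') (wSA i α) (fun _ => 1)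
  ΦY := fun U α => probeK b (fun x x' : SiteY i => par (cfg U) x x') (wSA i α) (fun _ => 1)

variable {bI : FBondY i → IBondY i}

omit [DecidableEq κ] in
/-- the anchors of the cut family are `holderProbesS`'s. [cite: Balaban1985BackgroundPropagators, (3.43) p.398, bookkeeping] -/
theorem blkPX_SA : (holderProbesSA i b B cfg par bI).blkPX = blkPK (sIK i bI) := rfl

omit [DecidableEq κ] in
/-- `ΦY = ΦX` for the cut family. [cite: Balaban1985BackgroundPropagators, (3.43) p.398, bookkeeping] -/
theorem ΦY_SA_eq_ΦX_SA (U : B.Cfg) (α : ℝ) : (holderProbesSA i b B cfg par bI).ΦY U α = (holderProbesSA i b B cfg par bI).ΦX U α := rfl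

omit [DecidableEq κ] in
/-- ★ at a SAME-BLOCK pair the cut pair probe IS `holderProbesS`'s pair probe. [cite: Balaban1985BackgroundPropagators, (3.40) p.397, bookkeeping] -/
theorem ΦX_SA_inl_of_eq (U : B.Cfg) (α : ℝ) (F : XSK κ i → ℝ) {z z' : SiteY i} (h : blkOf i.D.toDomains z = blkOf i.D.toDomains z') (ν : Fin (d + 1)) (c c' : κ) :
    (holderProbesSA i b B cfg par bI).ΦX U α F (Sum.inl ((z, z'), ν, c, c')) = (holderProbesS i b B cfg par bI).ΦX U α F (Sum.inl ((z, z'), ν, c, c')) := by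
  show probeK b _ (wSA i α) (fun _ => 1) F _ = probeK b _ (wS i α) (fun _ => 1) F _
  rw [probeK_inl, probeK_inl, wSA_of_eq i α h]

omit [DecidableEq κ] in
/-- ★ across blocks the cut pair probe VANISHES. [cite: Balaban1985BackgroundPropagators, (3.40) p.397 («|x−x′| ≦ 1»), bookkeeping] -/
theorem ΦX_SA_inl_of_ne (U : B.Cfg) (α : ℝ) (F : XSK κ i → ℝ) {z z' : SiteY i} (h : blkOf i.D.toDomains z ≠ blkOf i.D.toDomains z') (ν : Fin (d + 1)) (c c' : κ) :
    (holderProbesSA i b B cfg par bI).ΦX U α F (Sum.inl ((z, z'), ν, c, c')) = 0 := by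
  show probeK b _ (wSA i α) (fun _ => 1) F _ = 0
  rw [probeK_inl, wSA_of_ne i α h, zero_mul]

omit [DecidableEq κ] in
/-- the transported point probes are `holderProbesS`'s. [cite: Balaban1985BackgroundPropagators, (3.40) p.397, bookkeeping] -/
theorem ΦX_SA_inr_inl (U : B.Cfg) (α : ℝ) (F : XSK κ i → ℝ) (p : (SiteY i × SiteY i) × Fin (d + 1) × κ × κ) :
    (holderProbesSA i b B cfg par bI).ΦX U α F (Sum.inr (Sum.inl p)) = (holderProbesS i b B cfg par bI).ΦX U α F (Sum.inr (Sum.inl p)) := by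
  show probeK b _ (wSA i α) (fun _ => 1) F _ = probeK b _ (wS i α) (fun _ => 1) F _
  rw [probeK_inr_inl, probeK_inr_inl]

omit [DecidableEq κ] in
/-- the point probes are `holderProbesS`'s. [cite: Balaban1985BackgroundPropagators, (3.39) p.397, bookkeeping] -/
theorem ΦX_SA_inr_inr (U : B.Cfg) (α : ℝ) (F : XSK κ i → ℝ) (p : SiteY i × Fin (d + 1) × κ × κ) :
    (holderProbesSA i b B cfg par bI).ΦX U α F (Sum.inr (Sum.inr p)) = (holderProbesS i b B cfg par bI).ΦX U α F (Sum.inr (Sum.inr p)) := by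
  show probeK b _ (wSA i α) (fun _ => 1) F _ = probeK b _ (wS i α) (fun _ => 1) F _
  rw [probeK_inr_inr, probeK_inr_inr]

/-! ## §2 ★★ n06-d's site product rule with the hypothesis on the cut family only -/

variable [FiniteDimensional ℝ 𝔸]

/-- ★★ **THE PRODUCT RULE FOR THE SITE QUOTIENT `hqS`, READ THROUGH THE CUT PROBES** — `B9CoReadingCoordsHolderS.hqS_le_of_probes` with the hypothesis on the cut pair weight `wSA`:
`sI` 1-faithful on sites, `1 ≤ r`, `ζ` supported IN the block `β y`; if every cut pair probe and every (transported) point probe of the `(η·cR39)`-scaled coordinate model of `T` at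
`evDiagK f`, anchored within `r` of `y`, is `≤ c`, then `hqS (U(Γ)) α (ζη · T ν (f ⊗ E)) ≤ c·(‖ζ‖_α + |ζ|)`.  The proof is n06-d's verbatim: the pair probe enters only when `ζ(z) ≠ 0 ≠ ζ(z′)`,
where `blkOf z = β y = blkOf z′` and `wSA = wS`. [cite: Balaban1985BackgroundPropagators, (3.40) p.397 + (3.43) p.398; Balaban1984PropagatorsII, (2.51)–(2.52) p.232 + (2.67) p.234] -/
theorem hqS_le_of_probesSA {sI : SiteY i → IBondY i}
    (hσ1 : ∀ z : SiteY i, (geomT i.D).dist (β i.hN i.D i.hk (sI z)) (blkOf i.D.toDomains z) ≤ 1) {r : ℝ} (hr : 1 ≤ r)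
    (g : SiteY i → SiteY i → 𝔸ˣ) (T : Fin (d + 1) → (SiteY i → 𝔸) →ₗ[ℝ] (SiteY i → 𝔸)) (f : SiteY i → ℝ) (α : ℝ) (z : SiteY i → ℝ)
    (y : IBondY i) {c : ℝ} (hc : 0 ≤ c) (hcut : ∀ w, z w ≠ 0 → blkOf i.D.toDomains w = β i.hN i.D i.hk y)
    (hP : ∀ p : PK (SiteY i) (Fin (d + 1)) κ, (geomT i.D).dist (β i.hN i.D i.hk (blkPK sI p)) (β i.hN i.D i.hk y) ≤ r →
      |probeK b g (wSA i α) (fun _ => (1 : ℝ)) (((etaS i * cR39 b) • coordOpK b T) (evDiagK f)) p| ≤ c)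
    (E : BallY 𝔸) (ν : Fin (d + 1)) :
    hqS i g α (fun w => ((z w * etaS i : ℝ) : ℂ) • T ν (liftY f (E : 𝔸)) w) ≤ c * (geoTP (toKT i)).cutH α z := by
  classical
  set F : XSK κ i → ℝ := ((etaS i * cR39 b) • coordOpK b T) (evDiagK f) with hF
  set Ψ : SiteY i → 𝔸 := (etaS i • T ν) (liftY f (E : 𝔸)) with hΨ
  have hE : ‖(E : 𝔸)‖ ≤ 1 := mem_closedBall_zero_iff.1 E.2
  have hη : 0 < etaS i := etaS_pos i
  set S₀ : ℝ := (toKT i).supF z with hS₀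
  have hcutH : (geoTP (toKT i)).cutH α z = hqTP (toKT i) α z + S₀ := rfl
  have hS₀0 : 0 ≤ S₀ := Real.iSup_nonneg fun _ => abs_nonneg _
  have hzS : ∀ w, |z w| ≤ S₀ := fun w => le_ciSup (f := fun w => |z w|) (Finite.bddAbove_range _) w
  have hHz0 : 0 ≤ hqTP (toKT i) α z := hqTP_nonneg (toKT i) α z
  have hcH0 : 0 ≤ c * (geoTP (toKT i)).cutH α z := mul_nonneg hc (by rw [hcutH]; exact add_nonneg hHz0 hS₀0)
  have hnear : ∀ w, z w ≠ 0 → (geomT i.D).dist (β i.hN i.D i.hk (sI w)) (β i.hN i.D i.hk y) ≤ r := by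
    intro w hw
    have h := hσ1 w
    rw [hcut w hw] at h
    exact h.trans hr
  have hFs : ∀ cc' : κ, assembleK b ν cc' F = cR39 b • (etaS i • T ν) (liftY f (b cc')) := by
    intro cc'
    rw [hF, LinearMap.smul_apply, assembleK_smul, assembleK_coordOpK, assembleK_evDiagK, LinearMap.smul_apply, smul_smul, mul_comm]
  have hFp : ∀ (x : SiteY i) (cc cc' : κ), F (x, ν, cc, cc') = cR39 b * b.repr ((etaS i • T ν) (liftY f (b cc')) x) cc := by
    intro x cc cc'
    rw [hF, LinearMap.smul_apply, Pi.smul_apply, coordOpK_evDiagK, smul_eq_mul, LinearMap.smul_apply, Pi.smul_apply, map_smul,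
      Finsupp.smul_apply, smul_eq_mul]
    ring
  -- (a) the CUT pair probe at an anchored `x` with a SAME-BLOCK partner `x′`
  have hpair : ∀ x x' : SiteY i, z x ≠ 0 → blkOf i.D.toDomains x = blkOf i.D.toDomains x' → wS i α x x' * ‖Ψ x - R (g x x') (Ψ x')‖ ≤ c := by
    intro x x' hx hblk
    have h1 := fun cc cc' : κ => hP (Sum.inl ((x, x'), ν, cc, cc')) (hnear x hx)
    refine wnorm_le_of_coords b (shiftR (g x x') x' ∘ₗ (etaS i • T ν)) f x (wS_nonneg i α x x') hc (fun cc cc' => ?_) hE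
    have h2 := h1 cc cc'
    rw [probeK_inl, wSA_of_eq i α hblk] at h2
    simp only [hFs cc', Pi.smul_apply, R_smul, ← smul_sub, map_smul, Finsupp.smul_apply, smul_eq_mul] at h2
    exact h2
  -- (b) point probe at an anchored `x`
  have hpt : ∀ x : SiteY i, z x ≠ 0 → ‖Ψ x‖ ≤ c := by
    intro x hx
    have h1 := fun cc cc' : κ => hP (Sum.inr (Sum.inr (x, ν, cc, cc'))) (hnear x hx)
    have key := wnorm_le_of_coords b (etaS i • T ν) f x zero_le_one hc (fun cc cc' => ?_) hE
    · rw [one_mul] at key; exact key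
    have h2 := h1 cc cc'
    rw [probeK_inr_inr, hFp] at h2
    exact h2
  -- (c) transported point probe of the pair `(x, x′)`, anchored at `x′`
  have hptR : ∀ x x' : SiteY i, z x' ≠ 0 → ‖R (g x x') (Ψ x')‖ ≤ c := by
    intro x x' hx'
    have h1 := fun cc cc' : κ => hP (Sum.inr (Sum.inl ((x, x'), ν, cc, cc'))) (hnear x' hx')
    have key := wnorm_le_of_coords b (transR (g x x') x' ∘ₗ (etaS i • T ν)) f x zero_le_one hc (fun cc cc' => ?_) hE
    · rw [one_mul] at key; exact key
    have h2 := h1 cc cc'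
    rw [probeK_inr_inl] at h2
    simp only [hFs cc', Pi.smul_apply, R_smul, map_smul, Finsupp.smul_apply, smul_eq_mul] at h2
    exact h2
  have hns : ∀ (r : ℝ) (X : 𝔸), ‖((r : ℝ) : ℂ) • X‖ = |r| * ‖X‖ := fun r X => by rw [norm_smul, Complex.norm_real, Real.norm_eq_abs]
  have hΨw : ∀ w, ((z w * etaS i : ℝ) : ℂ) • T ν (liftY f (E : 𝔸)) w = ((z w : ℝ) : ℂ) • Ψ w := by
    intro w
    rw [hΨ, LinearMap.smul_apply, Pi.smul_apply, ← Complex.coe_smul (etaS i), smul_smul, Complex.ofReal_mul]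
  unfold hqS
  refine Real.iSup_le (fun q => ?_) hcH0
  obtain ⟨x, x'⟩ := q
  split_ifs with hne
  swap
  · exact hcH0
  simp only [hΨw]
  rw [div_eq_mul_inv]
  show ‖R (g x x') (((z x' : ℝ) : ℂ) • Ψ x') - ((z x : ℝ) : ℂ) • Ψ x‖ * wS i α x x' ≤ c * (geoTP (toKT i)).cutH α z
  rw [hcutH, mul_add, mul_comm]
  have hq : ∀ v : ℝ, |v| * wS i α x x' = |v| / (torusSupNorm (toKT i).NB (x'.1 - x.1) / (nKT (toKT i))) ^ α := fun v => by
    simp only [wS, div_eq_mul_inv]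
  have hzH : |z x' - z x| * wS i α x x' ≤ hqTP (toKT i) α z := by rw [hq]; exact pair_le_hqTP (toKT i) α z x x' hne
  by_cases hx : z x = 0 <;> by_cases hx' : z x' = 0
  · rw [hx, hx']; simp only [Complex.ofReal_zero, zero_smul, R_zero, sub_zero, norm_zero, mul_zero]
    exact add_nonneg (mul_nonneg hc hHz0) (mul_nonneg hc hS₀0)
  · rw [hx]; simp only [Complex.ofReal_zero, zero_smul, sub_zero, R_smul, hns]
    calc wS i α x x' * (|z x'| * ‖R (g x x') (Ψ x')‖) = (|z x' - z x| * wS i α x x') * ‖R (g x x') (Ψ x')‖ := by rw [hx, sub_zero]; ring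
      _ ≤ hqTP (toKT i) α z * c := mul_le_mul hzH (hptR x x' hx') (norm_nonneg _) hHz0
      _ ≤ c * hqTP (toKT i) α z + c * S₀ := by nlinarith [mul_nonneg hc hS₀0]
  · rw [hx']; simp only [Complex.ofReal_zero, zero_smul, R_zero, zero_sub, norm_neg, hns]
    calc wS i α x x' * (|z x| * ‖Ψ x‖) = (|z x' - z x| * wS i α x x') * ‖Ψ x‖ := by rw [hx', zero_sub, abs_neg]; ring
      _ ≤ hqTP (toKT i) α z * c := mul_le_mul hzH (hpt x hx) (norm_nonneg _) hHz0
      _ ≤ c * hqTP (toKT i) α z + c * S₀ := by nlinarith [mul_nonneg hc hS₀0]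
  · -- both non-zero: both sites lie in the block of `y` — the SAME block — and the cut pair probe is the printed one
    have hblk : blkOf i.D.toDomains x = blkOf i.D.toDomains x' := (hcut x hx).trans (hcut x' hx').symm
    have hsplit : R (g x x') (((z x' : ℝ) : ℂ) • Ψ x') - ((z x : ℝ) : ℂ) • Ψ x =
        ((z x : ℝ) : ℂ) • (R (g x x') (Ψ x') - Ψ x) + ((z x' - z x : ℝ) : ℂ) • R (g x x') (Ψ x') := by
      rw [R_smul, smul_sub, Complex.ofReal_sub, sub_smul]; abel
    rw [hsplit]
    calc wS i α x x' * ‖((z x : ℝ) : ℂ) • (R (g x x') (Ψ x') - Ψ x) + ((z x' - z x : ℝ) : ℂ) • R (g x x') (Ψ x')‖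
        ≤ wS i α x x' * (|z x| * ‖Ψ x - R (g x x') (Ψ x')‖ + |z x' - z x| * ‖R (g x x') (Ψ x')‖) := by
          refine mul_le_mul_of_nonneg_left ((norm_add_le _ _).trans ?_) (wS_nonneg i α x x')
          rw [hns, hns, norm_sub_rev]
      _ = |z x| * (wS i α x x' * ‖Ψ x - R (g x x') (Ψ x')‖) + (|z x' - z x| * wS i α x x') * ‖R (g x x') (Ψ x')‖ := by ring
      _ ≤ S₀ * c + hqTP (toKT i) α z * c := add_le_add (mul_le_mul (hzS x) (hpair x x' hx hblk) (mul_nonneg (wS_nonneg i α x x') (norm_nonneg _)) hS₀0)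
          (mul_le_mul hzH (hptR x x' hx') (norm_nonneg _) hHz0)
      _ = c * hqTP (toKT i) α z + c * S₀ := by ring

end Site

/-! ## §3 ★★ The (3.43) co-reading `H1ReadsNbr` of `kernelFamilyS` at the cut site carrier -/

section H1

variable [FiniteDimensional ℝ 𝔸] (i : KIdx d ℓ hd hL b₀ b₁) (b : Module.Basis κ ℝ 𝔸)
variable (B : B9.Backgrounds) (cfg : B.Cfg → CfgY 𝔸 i) (O : SiteOpY 𝔸 i) (par : SiteParY 𝔸 i) (U₁ : B.Cfg)
variable {bI : FBondY i → IBondY i}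

/-- ★★ **`H1ReadsNbr (kernelFamilyS i B cfg O par) U₁ (holderProbesSA …) (RelB i) r (blkSK (sIK bI)) (blkSK (sIK bI)) evSK evSK (DcoS ∘ₗ GcoS) (GcoS ∘ₗ DscoS)`** for EVERY site-sector letter
`O`, EVERY `U₁`, every real basis, every radius `r ≥ 1`, given `bI` carrier-faithful (`hβI`) and 1-faithful (`hβ1`) — n06-d's `h1ReadsNbr_kernelFamilyS_coords` AT THE CUT CARRIER
(`hqS_le_of_probesSA` twice). [cite: Balaban1985BackgroundPropagators, (3.43) p.398 + (3.40)–(3.42) p.397; Balaban1984PropagatorsII, (2.51)–(2.52) p.232 + (2.67) p.234] -/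
theorem h1ReadsNbr_kernelFamilyS_coordsSA [Fintype (geo9K i).Site]
    (hβI : ∀ (x : FBondY i) (c : IBondY i), blkV1 i.hN i.D x = β i.hN i.D i.hk c → β i.hN i.D i.hk (bI x) = blkV1 i.hN i.D x)
    (hβ1 : ∀ x : FBondY i, (geomT i.D).dist (β i.hN i.D i.hk (bI x)) (blkV1 i.hN i.D x) ≤ 1) {r : ℝ} (hr : 1 ≤ r) :
    H1ReadsNbr (kernelFamilyS i B cfg O par) U₁ (holderProbesSA i b B cfg par bI) (RelB i) r (blkSK i (sIK i bI)) (blkSK i (sIK i bI))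
      (evSK i) (evSK i) (DcoS i b B cfg U₁ ∘ₗ GcoS i b B cfg O U₁) (GcoS i b B cfg O U₁ ∘ₗ DscoS i b B cfg U₁) := by
  obtain ⟨hoff, hbd⟩ := off_bound_evSK (κ := κ) i (sIK_faithful i hβI)
  refine ⟨hoff, hbd, hoff, hbd, fun lam => geo9K_supNorm_nonneg i lam, fun α ζ => geo9K_cutH_nonneg i α ζ, ?_⟩
  intro lam α ζ y c hc hcut hPY hPX
  have h0 : 0 ≤ c * (geo9K i).cutH α ζ := mul_nonneg hc (geo9K_cutH_nonneg i α ζ)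
  cases lam with
  | inr J => cases ζ with
    | inl zz => exact h0
    | inr zz => exact h0
  | inl f => cases ζ with
    | inr zz => exact h0
    | inl zz =>
        show (⨆ E : BallY 𝔸, hLatS i O par (cfg U₁) (liftY f (E : 𝔸)) α zz) ≤ c * (geoTP (toKT i)).cutH α zz
        have hev : evSK (κ := κ) i (Sum.inl f) = evDiagK f := rfl
        rw [DcoS_comp_GcoS, hev] at hPY
        rw [GcoS_comp_DscoS, hev] at hPX
        refine iSup_ball_le (fun E => ?_) h0
        unfold hLatS
        refine Real.iSup_le (fun q => ?_) h0
        split_ifs with hside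
        · exact hqS_le_of_probesSA i b (sIK_dist_le_one i hβ1) hr (par (cfg U₁))
            (fun ν => (cdSL i (cfg U₁) ν).restrictScalars ℝ ∘ₗ (O (cfg U₁)).restrictScalars ℝ) f α zz y hc hcut hPY E q.1
        · exact hqS_le_of_probesSA i b (sIK_dist_le_one i hβ1) hr (par (cfg U₁))
            (fun ν => (O (cfg U₁)).restrictScalars ℝ ∘ₗ (cdsSL i (cfg U₁) ν).restrictScalars ℝ) f α zz y hc hcut hPX E q.1

/-- ★ **THE SITE (3.43) CO-READING AT THE CUT CARRIER UNDER THE PINS, RADIUS 2**: `blk = blkY = blkSK (sIK bI)`, `Gp = GcoS …`, `D = DcoS …`, `Ds = DscoS …` ⇒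
`H1ReadsNbr (kernelFamilyS …) U₁ (holderProbesSA …) (RelB i) 2 blk blkY evSK evSK (D ∘ₗ Gp) (Gp ∘ₗ Ds)` — the twin of `site_h1ReadsNbr_of_pins` (ed. 27's `hH1`) that a re-pinned edition
(`h𝔭 : 𝔭 x = holderProbesSA …`) consumes verbatim. [cite: Balaban1985BackgroundPropagators, (3.43) p.398; Balaban1984PropagatorsII, (2.51)–(2.52) p.232] -/
theorem site_h1ReadsNbr_of_pinsSA [Fintype (geo9K i).Site]
    (hβI : ∀ (x : FBondY i) (c : IBondY i), blkV1 i.hN i.D x = β i.hN i.D i.hk c → β i.hN i.D i.hk (bI x) = blkV1 i.hN i.D x)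
    (hβ1 : ∀ x : FBondY i, (geomT i.D).dist (β i.hN i.D i.hk (bI x)) (blkV1 i.hN i.D x) ≤ 1)
    {blk blkY : XSK κ i → IBondY i} {G D Ds : (XSK κ i → ℝ) →ₗ[ℝ] (XSK κ i → ℝ)} (hblk : blk = blkSK i (sIK i bI)) (hblkY : blkY = blkSK i (sIK i bI))
    (hG : G = GcoS i b B cfg O U₁) (hD : D = DcoS i b B cfg U₁) (hDs : Ds = DscoS i b B cfg U₁) :
    H1ReadsNbr (kernelFamilyS i B cfg O par) U₁ (holderProbesSA i b B cfg par bI) (RelB i) 2 blk blkY (evSK i) (evSK i) (D ∘ₗ G) (G ∘ₗ Ds) := by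
  subst hblk hblkY hG hD hDs
  exact h1ReadsNbr_kernelFamilyS_coordsSA i b B cfg O par U₁ hβI hβ1 (by norm_num)

end H1

end Literature.MathematicalPhysics.QuantumFieldTheory.Balaban1983to89.B9CoReadingCoordsHolderSAdm

end
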